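import Mathlib
import HarnessLib
import Literature.MathematicalPhysics.QuantumLattice.GaugeGroups
import Literature.MathematicalPhysics.QuantumFieldTheory.ConstructiveQFTWave0
import Literature.MathematicalPhysics.QuantumFieldTheory.UnitaryCayleyChart
import Summits.Ventures.LatticeQCDFlow.Scaling.BarriersTransport
import Summits.Ventures.LatticeQCDFlow.Scaling.AccurateTransportContraction

/-!
# LatticeQCDFlow / Scaling — barrier supplement v2.6: the contraction law is ε-ROBUST (`coLip ≥ e^{-C}β^{c}` for every
`ε ≤ 1/4`-accurate map)

HONEST FRAMING: exact (Metropolis-corrected) sampling algorithms for lattice gauge theory;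
figures of merit are autocorrelation/cost numbers at stated couplings and volumes; no
continuum-physics claim.

THEORY-2.md §5.11 (theory seat GEN-11).  One PROVED supplement to the T4 entries `ExactnessVsExpressivity`
(`Scaling/Barriers.lean`) and `TransportContractionLaw` (`Scaling/BarriersTransport.lean`), in the barrier-docstring format
(`technique_class` · `blocks` · `because` · `evasions_known` · `scope_caveats` · `nearest_prior_art` · `status`), a
`def … : Prop` immediately DISCHARGED by the instances of `Scaling/AccurateTransportContraction.lean`.  It records that
the contraction law needs NO exactness: it binds every co-Lipschitz map whose push-forward of product Haar dominates the
Wilson law up to `ε ≤ 1/4` on measurable sets — i.e. every approximate flow that is useful at all — with the same rate.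
The barrier NAMES of record (VolumeScalingOfTraining, TopologicalModeCollapse, ExactnessVsExpressivity,
FermionDeterminantCost) are unchanged; literature under `nearest_prior_art` is CONTEXT found by search, nothing imported.
-/

noncomputable section

namespace Summit.Ventures.LatticeQCDFlow.Barriers

open scoped Matrix.Norms.Frobenius
open Literature.MathematicalPhysics.QuantumFieldTheory.UnitaryCayley (𝔾)
open Literature.MathematicalPhysics.QuantumLattice (u1Rep unitaryFundamentalRep fundamentalRep)

/-- **Supplement (AccurateTransportContractionLaw) to ExactnessVsExpressivity / TransportContractionLaw —
the polynomial contraction law holds for EVERY `ε`-accurate map, `ε ≤ 1/4`.**  For `G = U(1)` (chordal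
metric), `G = U(N)`, `N ≥ 1`, and `G = SU(N)`, `N ≥ 2` (Hilbert–Schmidt metric), Wilson action in the
defining representation, `d ≥ 2`: there are `c = 1/(16d)`, `C`, `β₀` such that for every `L ≥ 4`, every
`β ≥ β₀`, every `ε ∈ [0, 1/4]` and every map `T : G^E → G^E` that is `K'`-co-Lipschitz for the sup metric
(`dist x y ≤ K'·dist (Tx) (Ty)`) and `ε`-ACCURATE in the one-sided sense
`μ_{Λ_L,β}(B) ≤ (T_*Haar^{⊗E})(B) + ε` for all measurable `B` (implied by total variation `≤ ε`), one has
`log K' ≥ c·log β − C` (no Lipschitz, injectivity, smoothness or measurability hypothesis).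
technique_class: deterministic samplers realised as ONE map of the product-Haar (strong-coupling) prior
  — trivializing maps and gauge-equivariant coupling / residual / spectral / continuous flows — read at
  ANY useful accuracy (total-variation error `≤ 1/4`), any depth; in particular every trained flow whose
  push-forward is within `1/4` of the target in total variation.
blocks: "approximate flows escape the transport rigidity entirely": they escape the EXPANSION law
  (`TransportExpansionLaw`, an exactness artefact) but not the contraction law — an `ε`-accurate map from
  the Haar prior must contract some pair of configurations by `e^{-C}·β^{1/(16d)}`, uniformly in `L`;
  composed of `n` layers each `Λ'`-co-Lipschitz this reads `n·log Λ' ≥ (1/16d)·log β − C`.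
because: PROVED `Theory2.Lattice.U1.accurateTransportContraction`, `….UN.accurateTransportContraction`,
  `….SUN.accurateTransportContraction` (`accurateTransportContraction_of_laplaceHalfMass`: the PROVED
  Laplace half-mass law puts `μ_β`-mass `≥ 1/2` on a set `E` of prior mass `≤ (c₀/β)^{nTr/2}`,
  `nTr ≥ κL^d/8`; accuracy gives `(T_*π)(E) ≥ 1/4`; a PACKING argument — inner regularity, a finite
  `r`-net of a compact `F ⊆ E`, the Vitali `4r`-covering lemma, and "the preimage of a `4r`-ball under a
  `K'`-co-Lipschitz map has diameter `≤ 8K'r`" — gives `1/8 < π(F^r)·((A/a)·8^κ·K'^κ)^{#E}` for every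
  `r ∈ (0,1)`, the radius cancels, and `r → 0⁺` yields `κd·log K' ≥ (κ/16)·log β − O(1)` per link; no
  partition function, no density, hence no exactness is used).
evasions_known: none on this side — it is paid, not evaded (a heat-bath-like single-link squeeze of
  ratio `β^{Θ(1)}` supplies it; annealed ladders distribute it as `Σ log(β_{k+1}/β_k)`); the law does
  NOT constrain KL / ESS beyond `TV ≤ 1/4` and says nothing about training cost.
scope_caveats: necessary, not sufficient; one-sided accuracy at the single set `E` is all that is used,
  so the constant is weak (`1/(16d)` against the entropy-budget coefficient `dim G·(d−1)/2` per site,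
  which is a log-Jacobian statement, `EntropyBudgetLaw`); `L ≥ 4`; `ε ≤ 1/4` can be replaced by any
  `ε < 1/2` at the price of the constant `C`.
nearest_prior_art: as `TransportContractionLaw` (sampler-complexity theory in other currencies:
  Holzmüller–Bach arXiv:2303.03237 Thm 6; Syed et al. arXiv:1905.02939 Thm 3; Woodard–Schmidler–Huber
  EJP 14 (2009); Mathews–Schmidler arXiv:2208.06672); volume-uniform Lipschitz transport from a
  Gaussian reference (Bauerschmidt–Bodineau–Dagallier arXiv:2307.07619 Thm 7, Ex. 10; Shenfeld
  arXiv:2205.01642); "measure + Lipschitz ⇒ rigidity" in Alexandrov geometry (N. Li, Lipschitz-volume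
  rigidity, arXiv:1110.5498) shares only the elementary mechanism.  Searched (THEORY-2.md §3.3 v2.6
  presearch, corpus fts+vec and galaxy): no printed co-Lipschitz / packing lower bound for approximate
  transport onto a lattice gauge measure.
status: PROVED (`accurateTransportContractionLaw`). -/
def AccurateTransportContractionLaw : Prop :=
  (∀ d : ℕ, 2 ≤ d → Theory2.Lattice.AccurateTransportContraction d 1 Circle u1Rep) ∧
  (∀ d N : ℕ, 2 ≤ d → 1 ≤ N →
    @Theory2.Lattice.AccurateTransportContraction d N (𝔾 N) _ Subtype.metricSpace
      Theory2.Lattice.UN.isTopologicalGroup_hs Theory2.Lattice.UN.compactSpace_hs _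
      Theory2.Lattice.UN.borelSpace_hs (unitaryFundamentalRep (Fin N) ℂ)) ∧
  (∀ d N : ℕ, 2 ≤ d → 2 ≤ N →
    @Theory2.Lattice.AccurateTransportContraction d N (Matrix.specialUnitaryGroup (Fin N) ℂ) _
      Subtype.metricSpace Theory2.Lattice.SUN.isTopologicalGroup_hs Theory2.Lattice.SUN.compactSpace_hs _
      Theory2.Lattice.SUN.borelSpace_hs (fundamentalRep (Fin N)))

/-- Discharge of `AccurateTransportContractionLaw` by the three instances of
`Scaling/AccurateTransportContraction.lean`. -/
theorem accurateTransportContractionLaw : AccurateTransportContractionLaw :=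
  ⟨Theory2.Lattice.U1.accurateTransportContraction, Theory2.Lattice.UN.accurateTransportContraction,
    Theory2.Lattice.SUN.accurateTransportContraction⟩

/-- The ε-robust law implies the exact contraction package `TransportContractionLaw`
(`Scaling/BarriersTransport.lean`) entry by entry. -/
theorem transportContractionLaw_of_accurate (h : AccurateTransportContractionLaw) : TransportContractionLaw :=
  ⟨fun d hd => Theory2.Lattice.exactTransportContraction_of_accurate u1Rep (h.1 d hd),
    fun d N hd hN => @Theory2.Lattice.exactTransportContraction_of_accurate N (𝔾 N) _ Subtype.metricSpace
      Theory2.Lattice.UN.isTopologicalGroup_hs Theory2.Lattice.UN.compactSpace_hs _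
      Theory2.Lattice.UN.borelSpace_hs (unitaryFundamentalRep (Fin N) ℂ) d (h.2.1 d N hd hN),
    fun d N hd hN => @Theory2.Lattice.exactTransportContraction_of_accurate N
      (Matrix.specialUnitaryGroup (Fin N) ℂ) _ Subtype.metricSpace Theory2.Lattice.SUN.isTopologicalGroup_hs
      Theory2.Lattice.SUN.compactSpace_hs _ Theory2.Lattice.SUN.borelSpace_hs (fundamentalRep (Fin N)) d
      (h.2.2 d N hd hN)⟩

end Summit.Ventures.LatticeQCDFlow.Barriers

end
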